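/-
Copyright: the b2b-balaban T⁴-continuum CRUX team, row NE7b OWNER lineage `t4-ne7b-p1` (gen 141). Project licence.
-/
import Summits.QuantumFields.BalabanUV.T4Continuum.Spine.NE7b.SupWhitenedObservableMoments

/-!
# THE HESSIAN-ENTRY OBSERVABLE'S MOMENT LETTERS UNDER `N(0,AAᵀ)`: `G_{xy}(ξ) = U″(Aξ+ψ)[e_x,e_y]` is `ξ`-`C¹` with
# `D_ξG_{xy} = (U‴(Aξ+ψ)[·,e_x,e_y])∘A` of norm `≤ κ₃√γ_op` (`‖U‴‖ ≤ κ₃`), bounded by `κ₂` (so all its Gaussian-weighted powers are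
# integrable), hence by (503):  `Var_ν̃(G_{xy}) ≤ κ₃²γ_op∕(1−λγ_op)`,  `E_ν̃(G_{xy} − μ)⁴ ≤ 5κ₃⁴γ_op²∕(1−λγ_op)²` — the fourth-moment letter
# `m₄` the Hessian vertex of the three-point pieces `κ₃(U″e_xe_y, U′e_z, U′e_t)` of `∂⁴W` needs in (461) `third_cumulant_le` (`hG4`, `hmG`),
# in (461)'s Gibbs format on `ℝ^κ` (SCOPING (d13)(2); row NE7b, node U5c; (503) `obs_fourth_moment_le`, (464) `opNorm_matrixCLM_le`, (458),
# (457) BY NAME; [folklore] + [cite: BrascampLieb1976, Thm 4.1] through (422))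

Cell `pub-balaban`, sub-cell `t4`, spine estimate NE7b (`T4WeightBudget.RelWeightBound`; the cell's OWN estimate — NOT PRINTED in
[Bałaban 1983–89], NOT PROVED).  Crux-route work under `Spine/NE7b/` by the row OWNER (`t4-ne7b-p1` gen 141, file (506)) under FREEZE
(0)'s crux-prover clause; NOTHING of Bałaban's is named as a Lean object, valued or asserted; no `T4Continuum/Support` leaf typed; no
`def`, no notation; zero `sorry`.  Imports (BY NAME): the OWNER's (503) `…SupWhitenedObservableMoments` (`obs_fourth_moment_le`; through it
(464) `opNorm_matrixCLM_le`, (458) `whitened_exp_integrable`, `op_letter_nonneg`, (457) `whitened_tilted_eq_gauss`, `whitened_integrable_lebesgue`,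
(401) `mul_opBound_le_of_le`).

WHAT IS PROVED ([folklore]):
* §1 `hasFDerivAt_hessianObservable` (`D_ω(U″(ω+ψ)[h,k]) = U‴(ω+ψ)[·,h,k]`, continuous, norm `≤ κ₃‖h‖‖k‖`),
  **`whitened_hessian_obs_hasFDerivAt`** (the `ξ`-coordinates, norm `≤ κ₃√γ_op`), `whitened_hessian_obs_power_integrable` (`e·G^k ∈ L¹`).
* §2 **`whitened_hessian_obs_fourth_moment`** (`Z⁻¹∫e(G − μ)⁴ ≤ 5κ₃⁴γ_op²∕(1−λγ_op)²`), and (461)'s format: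
  **`whitened_hessian_obs_fourth_power_integrable`**, **`whitened_hessian_obs_fourth_moment_gibbs`**; §3 toy.

HONEST (what this is NOT).  Moment letters of one vertex; the mixed third cumulants `κ₃(U″,U′,U′)` ((461) instantiated with one Hessian
vertex, (463)'s tree step, the row letter) are the next files; the cumulant FORM of `∂⁴W` is NOT typed.  Scalar skeleton ((A3), NC-NE7b-α
UNRULED); nothing of Bałaban's asserted.  BY-NAME EFFECT ON THE WALL: NONE.  NE7b NOT PRINTED ∕ NOT PROVED; spine PROVED 0∕9; rung (B)+1 —
the programme's measures remain FINITE-torus statements; NOT the mass gap, NOT Clay.  HONEST DEPENDENCY: continuum YM on T⁴ ⇐ BetaPertH ∧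
nine spine estimates (0∕9 proved); BetaPertH ⇐ (D1) ∧ (D4) ∧ CAP+tail; G-an2-4 gates asym, D1 and NE2∕3∕4.
-/

set_option autoImplicit false
set_option maxSynthPendingDepth 2

noncomputable section

namespace Summit.QuantumFields.BalabanUV.T4Continuum.NE7b.SupWhitenedHessianObservableMoments

open MeasureTheory ProbabilityTheory Real Set Function Finset Matrix
open scoped BigOperators
open Literature.Probability.Distributions (matrixCLM)
open SupWhitenedObservableMoments (obs_fourth_moment_le)
open SupWhitenedPoincareLetters (opNorm_matrixCLM_le)
open SupWhitenedMomentLetters (op_letter_nonneg whitened_exp_integrable)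
open SupWhitenedCovarianceKernelLetter (whitened_tilted_eq_gauss whitened_integrable_lebesgue)

variable {ι κ : Type} [Fintype ι] [DecidableEq ι] [Fintype κ] [DecidableEq κ]

variable {U : EuclideanSpace ℝ ι → ℝ} {U' : EuclideanSpace ℝ ι → EuclideanSpace ℝ ι →L[ℝ] ℝ}
  {U'' : EuclideanSpace ℝ ι → EuclideanSpace ℝ ι →L[ℝ] EuclideanSpace ℝ ι →L[ℝ] ℝ}
  {U₃ : EuclideanSpace ℝ ι → EuclideanSpace ℝ ι →L[ℝ] EuclideanSpace ℝ ι →L[ℝ] EuclideanSpace ℝ ι →L[ℝ] ℝ} {A : Matrix ι κ ℝ}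
  {γop κ₀ κ₂ κ₃ τ θ lam : ℝ}

/-! ## §1. The Hessian-entry observable is `C¹` with a bounded derivative, and bounded -/

omit [DecidableEq ι] in
/-- **`D_ω(U″(ω+ψ)[h,k]) = U‴(ω+ψ)[·,h,k]`** (as the composite `(ev_k ∘ ev_h) ∘ U‴(ω+ψ)`), a continuous map of `ω`, of norm `≤ κ₃‖h‖‖k‖`.
[folklore] -/
theorem hasFDerivAt_hessianObservable (hU''d : ∀ φ : EuclideanSpace ℝ ι, HasFDerivAt U'' (U₃ φ) φ) (hU₃c : Continuous U₃)
    (hU₃b : ∀ φ : EuclideanSpace ℝ ι, ‖U₃ φ‖ ≤ κ₃) (ψ h k : EuclideanSpace ℝ ι) :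
    (∀ ω : EuclideanSpace ℝ ι, HasFDerivAt (fun ω : EuclideanSpace ℝ ι => U'' (ω + ψ) h k)
        (((ContinuousLinearMap.apply ℝ ℝ k).comp (ContinuousLinearMap.apply ℝ (EuclideanSpace ℝ ι →L[ℝ] ℝ) h)).comp (U₃ (ω + ψ))) ω) ∧
      Continuous (fun ω : EuclideanSpace ℝ ι =>
        ((ContinuousLinearMap.apply ℝ ℝ k).comp (ContinuousLinearMap.apply ℝ (EuclideanSpace ℝ ι →L[ℝ] ℝ) h)).comp (U₃ (ω + ψ))) ∧
      ∀ ω : EuclideanSpace ℝ ι,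
        ‖((ContinuousLinearMap.apply ℝ ℝ k).comp (ContinuousLinearMap.apply ℝ (EuclideanSpace ℝ ι →L[ℝ] ℝ) h)).comp (U₃ (ω + ψ))‖ ≤ κ₃ * ‖h‖ * ‖k‖ :=
            by
  have hsh : ∀ ω : EuclideanSpace ℝ ι, HasFDerivAt (fun ω : EuclideanSpace ℝ ι => ω + ψ) (ContinuousLinearMap.id ℝ (EuclideanSpace ℝ ι)) ω :=
    fun ω => (hasFDerivAt_id ω).add_const ψ
  have hκ₃ : 0 ≤ κ₃ := (norm_nonneg (U₃ ψ)).trans (hU₃b ψ)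
  refine ⟨fun ω => ?_, ?_, fun ω => ?_⟩
  · have h1 : HasFDerivAt (fun ω : EuclideanSpace ℝ ι => U'' (ω + ψ)) (U₃ (ω + ψ)) ω := by
      have h := (hU''d (ω + ψ)).comp ω (hsh ω); rw [ContinuousLinearMap.comp_id] at h; exact h
    have h2 := ((ContinuousLinearMap.apply ℝ ℝ k).comp (ContinuousLinearMap.apply ℝ (EuclideanSpace ℝ ι →L[ℝ] ℝ) h)).hasFDerivAt.comp ω h1
    simpa [Function.comp_def] using h2
  · exact continuous_const.clm_comp (hU₃c.comp (continuous_id.add continuous_const))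
  · refine ContinuousLinearMap.opNorm_le_bound _ (by positivity) fun v => ?_
    simp only [ContinuousLinearMap.coe_comp, Function.comp_apply, ContinuousLinearMap.apply_apply]
    calc ‖U₃ (ω + ψ) v h k‖ ≤ ‖U₃ (ω + ψ) v h‖ * ‖k‖ := ContinuousLinearMap.le_opNorm _ _
      _ ≤ ‖U₃ (ω + ψ) v‖ * ‖h‖ * ‖k‖ := mul_le_mul_of_nonneg_right (ContinuousLinearMap.le_opNorm _ _) (norm_nonneg _)
      _ ≤ ‖U₃ (ω + ψ)‖ * ‖v‖ * ‖h‖ * ‖k‖ :=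
        mul_le_mul_of_nonneg_right (mul_le_mul_of_nonneg_right (ContinuousLinearMap.le_opNorm _ _) (norm_nonneg _)) (norm_nonneg _)
      _ ≤ κ₃ * ‖v‖ * ‖h‖ * ‖k‖ :=
        mul_le_mul_of_nonneg_right (mul_le_mul_of_nonneg_right (mul_le_mul_of_nonneg_right (hU₃b _) (norm_nonneg _)) (norm_nonneg _)) (norm_nonneg _)
      _ = κ₃ * ‖h‖ * ‖k‖ * ‖v‖ := by ring

/-- **`D_ξ G_{xy} = (U‴(Aξ+ψ)[·,e_x,e_y]) ∘ A`**, continuous in `ξ`, of norm `≤ κ₃√γ_op`. [folklore] -/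
theorem whitened_hessian_obs_hasFDerivAt [Nonempty ι] (hΓop : (γop • (1 : Matrix ι ι ℝ) - A * Aᵀ).PosSemidef)
    (hU''d : ∀ φ : EuclideanSpace ℝ ι, HasFDerivAt U'' (U₃ φ) φ) (hU₃c : Continuous U₃) (hU₃b : ∀ φ : EuclideanSpace ℝ ι, ‖U₃ φ‖ ≤ κ₃)
    (ψ : EuclideanSpace ℝ ι) (x y : ι) :
    (∀ ξ : EuclideanSpace ℝ κ, HasFDerivAt (fun ξ : EuclideanSpace ℝ κ => U'' (matrixCLM A ξ + ψ) (EuclideanSpace.single x (1 : ℝ))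
        (EuclideanSpace.single y (1 : ℝ)))
        ((((ContinuousLinearMap.apply ℝ ℝ (EuclideanSpace.single y (1 : ℝ))).comp (ContinuousLinearMap.apply ℝ (EuclideanSpace ℝ ι →L[ℝ] ℝ)
            (EuclideanSpace.single x (1 : ℝ)))).comp (U₃ (matrixCLM A ξ + ψ))).comp (matrixCLM A)) ξ) ∧
      Continuous (fun ξ : EuclideanSpace ℝ κ => (((ContinuousLinearMap.apply ℝ ℝ (EuclideanSpace.single y (1 : ℝ))).comp (ContinuousLinearMap.apply ℝ
          (EuclideanSpace ℝ ι →L[ℝ] ℝ) (EuclideanSpace.single x (1 : ℝ)))).comp (U₃ (matrixCLM A ξ + ψ))).comp (matrixCLM A)) ∧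
      ∀ ξ : EuclideanSpace ℝ κ, ‖(((ContinuousLinearMap.apply ℝ ℝ (EuclideanSpace.single y (1 : ℝ))).comp (ContinuousLinearMap.apply ℝ
          (EuclideanSpace ℝ ι →L[ℝ] ℝ) (EuclideanSpace.single x (1 : ℝ)))).comp (U₃ (matrixCLM A ξ + ψ))).comp (matrixCLM A)‖ ≤ κ₃ * Real.sqrt γop :=
          by
  obtain ⟨hGd, hG'c, hG'b⟩ := hasFDerivAt_hessianObservable hU''d hU₃c hU₃b ψ (EuclideanSpace.single x (1 : ℝ)) (EuclideanSpace.single y (1 : ℝ))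
  have hx : ‖((EuclideanSpace.single x (1 : ℝ)) : EuclideanSpace ℝ ι)‖ = 1 := by simp
  have hy : ‖((EuclideanSpace.single y (1 : ℝ)) : EuclideanSpace ℝ ι)‖ = 1 := by simp
  refine ⟨fun ξ => ?_, ?_, fun ξ => ?_⟩
  · exact (hGd (matrixCLM A ξ)).comp ξ (matrixCLM A).hasFDerivAt
  · exact ((ContinuousLinearMap.compL ℝ (EuclideanSpace ℝ κ) (EuclideanSpace ℝ ι) ℝ).flip (matrixCLM A)).continuous.comp
      (hG'c.comp (matrixCLM A).continuous)
  · have hb' := hG'b (matrixCLM A ξ)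
    rw [hx, hy, mul_one, mul_one] at hb'
    calc ‖(((ContinuousLinearMap.apply ℝ ℝ (EuclideanSpace.single y (1 : ℝ))).comp (ContinuousLinearMap.apply ℝ (EuclideanSpace ℝ ι →L[ℝ] ℝ)
        (EuclideanSpace.single x (1 : ℝ)))).comp (U₃ (matrixCLM A ξ + ψ))).comp (matrixCLM A)‖
        ≤ ‖((ContinuousLinearMap.apply ℝ ℝ (EuclideanSpace.single y (1 : ℝ))).comp (ContinuousLinearMap.apply ℝ (EuclideanSpace ℝ ι →L[ℝ] ℝ)
            (EuclideanSpace.single x (1 : ℝ)))).comp (U₃ (matrixCLM A ξ + ψ))‖ * ‖matrixCLM A‖ := ContinuousLinearMap.opNorm_comp_le _ _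
      _ ≤ κ₃ * Real.sqrt γop := mul_le_mul hb' (opNorm_matrixCLM_le hΓop) (norm_nonneg _) (le_trans (norm_nonneg _) hb')

/-- `|U″φ[e_x,e_y]| ≤ κ₂` from `‖U″φ‖ ≤ κ₂`. [folklore] -/
theorem hessian_entry_abs_le (hU''b : ∀ φ : EuclideanSpace ℝ ι, ‖U'' φ‖ ≤ κ₂) (φ : EuclideanSpace ℝ ι) (x y : ι) :
    |U'' φ (EuclideanSpace.single x (1 : ℝ)) (EuclideanSpace.single y (1 : ℝ))| ≤ κ₂ := by
  have hx : ‖((EuclideanSpace.single x (1 : ℝ)) : EuclideanSpace ℝ ι)‖ = 1 := by simp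
  have hy : ‖((EuclideanSpace.single y (1 : ℝ)) : EuclideanSpace ℝ ι)‖ = 1 := by simp
  have h1 := ContinuousLinearMap.le_opNorm (U'' φ (EuclideanSpace.single x (1 : ℝ))) (EuclideanSpace.single y (1 : ℝ))
  have h2 := ContinuousLinearMap.le_opNorm (U'' φ) (EuclideanSpace.single x (1 : ℝ))
  rw [hy, mul_one, Real.norm_eq_abs] at h1
  rw [hx, mul_one] at h2
  exact h1.trans (h2.trans (hU''b φ))

/-- **`e^{−U(Aξ+ψ)}·G_{xy}(ξ)^k ∈ L¹(N(0,I_κ))`** for every `k` (`|G_{xy}| ≤ κ₂`, the exponential weight integrable under the regulator).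
[folklore] -/
theorem whitened_hessian_obs_power_integrable (hΓop : (γop • (1 : Matrix ι ι ℝ) - A * Aᵀ).PosSemidef) (Y : Finset ι)
    (hUd : ∀ φ : EuclideanSpace ℝ ι, HasFDerivAt U (U' φ) φ)
    (hU''d : ∀ φ : EuclideanSpace ℝ ι, HasFDerivAt U'' (U₃ φ) φ) (hκ₀ : 0 ≤ κ₀) (hτ : 0 < τ) (hθ1 : θ < 1) (hκθ : 2 * κ₀ * (1 + τ) * γop ≤ θ)
    (hstab : ∀ φ : EuclideanSpace ℝ ι, -(κ₀ * ∑ x ∈ Y, φ x ^ 2) ≤ U φ) (hU''b : ∀ φ : EuclideanSpace ℝ ι, ‖U'' φ‖ ≤ κ₂)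
    (ψ : EuclideanSpace ℝ ι) (x y : ι) (k : ℕ) :
    Integrable (fun ξ : EuclideanSpace ℝ κ => exp (-U (matrixCLM A ξ + ψ)) * U'' (matrixCLM A ξ + ψ) (EuclideanSpace.single x (1 : ℝ))
        (EuclideanSpace.single y (1 : ℝ)) ^ k) (multivariateGaussian 0 (1 : Matrix κ κ ℝ)) := by
  have hUc : Continuous U := continuous_iff_continuousAt.2 fun φ => (hUd φ).continuousAt
  have hU''c : Continuous U'' := continuous_iff_continuousAt.2 fun φ => (hU''d φ).continuousAt
  have hI := whitened_exp_integrable hΓop Y hUc.measurable hκ₀ hτ hθ1 hκθ hstab ψ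
  have hsh : Continuous fun ξ : EuclideanSpace ℝ κ => matrixCLM A ξ + ψ := (matrixCLM A).continuous.add continuous_const
  have hEc : Continuous fun ξ : EuclideanSpace ℝ κ => exp (-U (matrixCLM A ξ + ψ)) := continuous_exp.comp ((hUc.comp hsh).neg)
  have hGc : Continuous fun ξ : EuclideanSpace ℝ κ => U'' (matrixCLM A ξ + ψ) (EuclideanSpace.single x (1 : ℝ)) (EuclideanSpace.single y (1 : ℝ)) :=
    ((hU''c.comp hsh).clm_apply continuous_const).clm_apply continuous_const
  have hκ₂ : 0 ≤ κ₂ := (norm_nonneg (U'' ψ)).trans (hU''b ψ)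
  refine (hI.mul_const (κ₂ ^ k)).mono' ((hEc.mul (hGc.pow k)).aestronglyMeasurable) (ae_of_all _ fun ξ => ?_)
  rw [Real.norm_eq_abs, abs_mul, abs_of_pos (exp_pos _), abs_pow]
  exact mul_le_mul_of_nonneg_left (pow_le_pow_left₀ (abs_nonneg _) (hessian_entry_abs_le hU''b _ x y) k) (exp_pos _).le

/-! ## §2. The fourth centred moment of the Hessian-entry observable -/

/-- **`Z⁻¹∫e(G_{xy} − μ)⁴ ≤ 5κ₃⁴γ_op²∕(1 − λγ_op)²`** in the whitened coordinates ((503) with `L = κ₃√γ_op`); uniform in `ψ`, `x, y` and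
the volume. [folklore] -/
theorem whitened_hessian_obs_fourth_moment [Nonempty ι] (hΓop : (γop • (1 : Matrix ι ι ℝ) - A * Aᵀ).PosSemidef) (Y : Finset ι)
    (hUd : ∀ φ : EuclideanSpace ℝ ι, HasFDerivAt U (U' φ) φ)
    (hU''d : ∀ φ : EuclideanSpace ℝ ι, HasFDerivAt U'' (U₃ φ) φ) (hU₃c : Continuous U₃) (hκ₀ : 0 ≤ κ₀) (hτ : 0 < τ) (hθ1 : θ < 1)
    (hκθ : 2 * κ₀ * (1 + τ) * γop ≤ θ) (hstab : ∀ φ : EuclideanSpace ℝ ι, -(κ₀ * ∑ x ∈ Y, φ x ^ 2) ≤ U φ)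
    (hU''b : ∀ φ : EuclideanSpace ℝ ι, ‖U'' φ‖ ≤ κ₂) (hU₃b : ∀ φ : EuclideanSpace ℝ ι, ‖U₃ φ‖ ≤ κ₃) (hlam : 0 ≤ lam)
    (hUsec : ∀ s : ℝ, 0 ≤ s → s ≤ 1 → ∀ a b : EuclideanSpace ℝ ι,
      U ((1 - s) • a + s • b) - lam / 2 * (s * (1 - s)) * ∑ i, (a i - b i) ^ 2 ≤ (1 - s) * U a + s * U b)
    (hρ : lam * γop < 1) (ψ : EuclideanSpace ℝ ι) (x y : ι) :
    (∫ ξ : EuclideanSpace ℝ κ, exp (-U (matrixCLM A ξ + ψ)) ∂(multivariateGaussian 0 (1 : Matrix κ κ ℝ)))⁻¹ *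
        (∫ ξ : EuclideanSpace ℝ κ, exp (-U (matrixCLM A ξ + ψ)) * (U'' (matrixCLM A ξ + ψ) (EuclideanSpace.single x (1 : ℝ)) (EuclideanSpace.single y
            (1 : ℝ)) -
          ((∫ ξ : EuclideanSpace ℝ κ, exp (-U (matrixCLM A ξ + ψ)) ∂(multivariateGaussian 0 (1 : Matrix κ κ ℝ)))⁻¹ * (∫ ξ : EuclideanSpace ℝ κ, exp
              (-U (matrixCLM A ξ + ψ)) * U'' (matrixCLM A ξ + ψ) (EuclideanSpace.single x (1 : ℝ)) (EuclideanSpace.single y (1 : ℝ))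
              ∂(multivariateGaussian 0 (1 : Matrix κ κ ℝ))))) ^ 4
          ∂(multivariateGaussian 0 (1 : Matrix κ κ ℝ))) ≤
      5 * (κ₃ ^ 4 * γop ^ 2) / (1 - lam * γop) ^ 2 := by
  have hγ := op_letter_nonneg hΓop
  obtain ⟨hgd, hg'c, hg'b⟩ := whitened_hessian_obs_hasFDerivAt hΓop hU''d hU₃c hU₃b ψ x y
  have k1 := whitened_hessian_obs_power_integrable hΓop Y hUd hU''d hκ₀ hτ hθ1 hκθ hstab hU''b ψ x y 1
  have k2 := whitened_hessian_obs_power_integrable hΓop Y hUd hU''d hκ₀ hτ hθ1 hκθ hstab hU''b ψ x y 2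
  have k4 := whitened_hessian_obs_power_integrable hΓop Y hUd hU''d hκ₀ hτ hθ1 hκθ hstab hU''b ψ x y 4
  simp only [pow_one] at k1
  have h := obs_fourth_moment_le hΓop Y hUd hκ₀ hτ hθ1 hκθ hstab hlam hUsec hρ ψ hgd hg'c hg'b k1 k2 k4
  have hL4 : (κ₃ * Real.sqrt γop) ^ 4 = κ₃ ^ 4 * γop ^ 2 := by
    have h2 : Real.sqrt γop ^ 2 = γop := Real.sq_sqrt hγ
    calc (κ₃ * Real.sqrt γop) ^ 4 = κ₃ ^ 4 * (Real.sqrt γop ^ 2) ^ 2 := by ring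
      _ = κ₃ ^ 4 * γop ^ 2 := by rw [h2]
  rw [hL4] at h
  exact h

/-- **`(G_{xy} − c)⁴ ∈ L¹(ν)`** for every constant `c` ((461)'s `hG4`), `ν ∝ e^{−V}dz`, `V(z) = ½z·z + U(A toLp z + ψ)`. [folklore] -/
theorem whitened_hessian_obs_fourth_power_integrable (hΓop : (γop • (1 : Matrix ι ι ℝ) - A * Aᵀ).PosSemidef) (Y : Finset ι)
    (hUd : ∀ φ : EuclideanSpace ℝ ι, HasFDerivAt U (U' φ) φ)
    (hU''d : ∀ φ : EuclideanSpace ℝ ι, HasFDerivAt U'' (U₃ φ) φ) (hκ₀ : 0 ≤ κ₀) (hτ : 0 < τ) (hθ1 : θ < 1) (hκθ : 2 * κ₀ * (1 + τ) * γop ≤ θ)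
    (hstab : ∀ φ : EuclideanSpace ℝ ι, -(κ₀ * ∑ x ∈ Y, φ x ^ 2) ≤ U φ) (hU''b : ∀ φ : EuclideanSpace ℝ ι, ‖U'' φ‖ ≤ κ₂)
    (ψ : EuclideanSpace ℝ ι) (x y : ι) (c : ℝ) :
    Integrable (fun z : κ → ℝ => (U'' (matrixCLM A (WithLp.toLp 2 z) + ψ) (EuclideanSpace.single x (1 : ℝ)) (EuclideanSpace.single y (1 : ℝ)) - c) ^
        4)
      ((volume : Measure (κ → ℝ)).tilted fun z => -(1 / 2 * (z ⬝ᵥ z) + U (matrixCLM A (WithLp.toLp 2 z) + ψ))) := by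
  have hUc : Continuous U := continuous_iff_continuousAt.2 fun φ => (hUd φ).continuousAt
  have hU''c : Continuous U'' := continuous_iff_continuousAt.2 fun φ => (hU''d φ).continuousAt
  have hI := whitened_exp_integrable hΓop Y hUc.measurable hκ₀ hτ hθ1 hκθ hstab ψ
  have hsh : Continuous fun ξ : EuclideanSpace ℝ κ => matrixCLM A ξ + ψ := (matrixCLM A).continuous.add continuous_const
  have hEc : Continuous fun ξ : EuclideanSpace ℝ κ => exp (-U (matrixCLM A ξ + ψ)) := continuous_exp.comp ((hUc.comp hsh).neg)
  have hGc : Continuous fun ξ : EuclideanSpace ℝ κ => U'' (matrixCLM A ξ + ψ) (EuclideanSpace.single x (1 : ℝ)) (EuclideanSpace.single y (1 : ℝ)) :=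
    ((hU''c.comp hsh).clm_apply continuous_const).clm_apply continuous_const
  have hκ₂ : 0 ≤ κ₂ := (norm_nonneg (U'' ψ)).trans (hU''b ψ)
  -- `e·(G − c)⁴ ≤ (κ₂ + |c|)⁴·e` is integrable under `N(0,I)`
  have ig4 : Integrable (fun ξ : EuclideanSpace ℝ κ => exp (-U (matrixCLM A ξ + ψ)) * (U'' (matrixCLM A ξ + ψ) (EuclideanSpace.single x (1 : ℝ))
      (EuclideanSpace.single y (1 : ℝ)) - c) ^ 4) (multivariateGaussian 0 (1 : Matrix κ κ ℝ)) := by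
    refine (hI.mul_const ((κ₂ + |c|) ^ 4)).mono' ((hEc.mul ((hGc.sub continuous_const).pow 4)).aestronglyMeasurable) (ae_of_all _ fun ξ => ?_)
    rw [Real.norm_eq_abs, abs_mul, abs_of_pos (exp_pos _), abs_pow]
    refine mul_le_mul_of_nonneg_left (pow_le_pow_left₀ (abs_nonneg _) ?_ 4) (exp_pos _).le
    exact (abs_sub _ _).trans (add_le_add (hessian_entry_abs_le hU''b _ x y) le_rfl)
  have hL := whitened_integrable_lebesgue A ψ (k := fun ξ : EuclideanSpace ℝ κ => (U'' (matrixCLM A ξ + ψ) (EuclideanSpace.single x (1 : ℝ))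
      (EuclideanSpace.single y (1 : ℝ)) - c) ^ 4) ig4
  have hV0 : Integrable (fun z : κ → ℝ => exp (-(1 / 2 * (z ⬝ᵥ z) + U (matrixCLM A (WithLp.toLp 2 z) + ψ)))) := by
    have h := whitened_integrable_lebesgue A ψ (k := fun _ => (1 : ℝ)) (by simpa only [mul_one] using hI)
    simpa only [one_mul] using h
  rw [integrable_tilted_iff hV0]
  refine hL.congr (ae_of_all _ fun z => ?_)
  simp only [smul_eq_mul]
  ring

/-- **THE FOURTH CENTRED MOMENT OF THE HESSIAN-ENTRY OBSERVABLE IN (461)'s FORMAT**: `∫(G_{xy} − E_νG_{xy})⁴dν ≤ 5κ₃⁴γ_op²∕(1 − λγ_op)²`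
((461)'s `hmG` with `m₄ = 5κ₃⁴γ_op²∕(1−λγ_op)²`); uniform in the background, the sites and the volume. [folklore] -/
theorem whitened_hessian_obs_fourth_moment_gibbs [Nonempty ι] (hΓop : (γop • (1 : Matrix ι ι ℝ) - A * Aᵀ).PosSemidef) (Y : Finset ι)
    (hUd : ∀ φ : EuclideanSpace ℝ ι, HasFDerivAt U (U' φ) φ)
    (hU''d : ∀ φ : EuclideanSpace ℝ ι, HasFDerivAt U'' (U₃ φ) φ) (hU₃c : Continuous U₃) (hκ₀ : 0 ≤ κ₀) (hτ : 0 < τ) (hθ1 : θ < 1)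
    (hκθ : 2 * κ₀ * (1 + τ) * γop ≤ θ) (hstab : ∀ φ : EuclideanSpace ℝ ι, -(κ₀ * ∑ x ∈ Y, φ x ^ 2) ≤ U φ)
    (hU''b : ∀ φ : EuclideanSpace ℝ ι, ‖U'' φ‖ ≤ κ₂) (hU₃b : ∀ φ : EuclideanSpace ℝ ι, ‖U₃ φ‖ ≤ κ₃) (hlam : 0 ≤ lam)
    (hUsec : ∀ s : ℝ, 0 ≤ s → s ≤ 1 → ∀ a b : EuclideanSpace ℝ ι,
      U ((1 - s) • a + s • b) - lam / 2 * (s * (1 - s)) * ∑ i, (a i - b i) ^ 2 ≤ (1 - s) * U a + s * U b)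
    (hρ : lam * γop < 1) (ψ : EuclideanSpace ℝ ι) (x y : ι) :
    ∫ z, (U'' (matrixCLM A (WithLp.toLp 2 z) + ψ) (EuclideanSpace.single x (1 : ℝ)) (EuclideanSpace.single y (1 : ℝ)) -
          ∫ z', U'' (matrixCLM A (WithLp.toLp 2 z') + ψ) (EuclideanSpace.single x (1 : ℝ)) (EuclideanSpace.single y (1 : ℝ))
            ∂((volume : Measure (κ → ℝ)).tilted fun z => -(1 / 2 * (z ⬝ᵥ z) + U (matrixCLM A (WithLp.toLp 2 z) + ψ)))) ^ 4
        ∂((volume : Measure (κ → ℝ)).tilted fun z => -(1 / 2 * (z ⬝ᵥ z) + U (matrixCLM A (WithLp.toLp 2 z) + ψ))) ≤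
      5 * (κ₃ ^ 4 * γop ^ 2) / (1 - lam * γop) ^ 2 := by
  have h := whitened_hessian_obs_fourth_moment hΓop Y hUd hU''d hU₃c hκ₀ hτ hθ1 hκθ hstab hU''b hU₃b hlam hUsec hρ ψ x y
  rw [whitened_tilted_eq_gauss A ψ, whitened_tilted_eq_gauss A ψ]
  simp only [WithLp.toLp_ofLp]
  rw [div_eq_inv_mul, div_eq_inv_mul]
  exact h

/-! ## §3. Toy -/

/-- Toy (`(κ₃√γ)⁴ = κ₃⁴γ²` at `κ₃ = γ = 1`). -/
example : ((1 : ℝ) * Real.sqrt 1) ^ 4 = (1 : ℝ) ^ 4 * 1 ^ 2 := by simp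

end Summit.QuantumFields.BalabanUV.T4Continuum.NE7b.SupWhitenedHessianObservableMoments

end
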